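import Summits.CriticalPhenomena.PercolationContinuityZ3.Theses.PercShatteringRace
import Literature.Probability.LatticeModels.ThermodynamicLimit
import Literature.Probability.Percolation.Percolation
import HarnessLib

/-!
# Crux `PercShatteringRace.FreeSusceptibilityPowerSaving` = S(1/2) (stmt-CriticalPhenomena-5786), line `bk-hyperscaling-tail-transfer` — stub `stub_p2pBridge` (census S⁺1, `P2P ⟹ S(1/2)`)

Helper file of the line lead c3 (prover-line-stmt-CriticalPhenomena-5786-c3-0),
`--supports stmt-CriticalPhenomena-5786`.  It proves the registered stub `stub_p2pBridge`, the
strategist's bridge S⁺1: a MESOSCOPIC POINTWISE bound on critical in-box connection probabilities,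
`P_{p_c}(0 ↔ y inside Λ_R) ≤ C R^{-1/2}` for every `R ≥ 1` and every `y ∈ Λ_R = box 3 R` outside the
small box `Λ_r`, `r = ⌊R^{5/6}⌋₊`, implies the crux S(1/2)
`Σ_{y ∈ Λ_R} P_{p_c}(0 ↔ y inside Λ_R) ≤ C' R^{5/2}`.

Proof: split the sum over `Λ_R` according to membership in `Λ_r`.  Inner part: every term is a
probability (`≤ 1`), and there are at most `#Λ_r = (2r+1)³ ≤ (3 R^{5/6})³ = 27 R^{5/2}` of them.
Outer part: every term is `≤ C R^{-1/2} ≤ C₊ R^{-1/2}` (`C₊ = max C 0`) by hypothesis, and there are at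
most `#Λ_R = (2R+1)³ ≤ 27 R³` of them, whence `≤ 27 C₊ R³ R^{-1/2} = 27 C₊ R^{5/2}`.  Witness constant
`27 + 27 C₊`.

Status remarks: the antecedent P2P is OPEN; it is jump-compatible exactly on the race budget
(`6/5 = 1 + b_max(1/2)`), it is not summit-strength (no `R`-uniform pointwise decay is asserted), and
it has no engine (census S⁺1).  This file is pure bookkeeping (finite sums and `rpow` algebra); no
definitions.
-/

noncomputable section

namespace Summit.CriticalPhenomena.PercolationContinuityZ3.Theorems

open MeasureTheory Finset
open Literature.Probability.Percolation Literature.Probability.LatticeModels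

namespace StubP2PBridge

/-- `(R^{5/6})³ = R^{5/2}` for `R ≥ 0`. [folklore] -/
theorem rpow_five_sixths_cube {x : ℝ} (hx : 0 ≤ x) :
    (x ^ ((5 : ℝ) / 6)) ^ (3 : ℕ) = x ^ ((5 : ℝ) / 2) := by
  rw [← Real.rpow_mul_natCast hx]
  norm_num

/-- `R³ · R^{-1/2} = R^{5/2}` for `R > 0`. [folklore] -/
theorem cube_mul_rpow_neg_half {x : ℝ} (hx : 0 < x) :
    x ^ (3 : ℕ) * x ^ (-(1 : ℝ) / 2) = x ^ ((5 : ℝ) / 2) := by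
  rw [← Real.rpow_natCast, ← Real.rpow_add hx]
  norm_num

end StubP2PBridge

open StubP2PBridge in
/-- **stub_p2pBridge (census S⁺1, the mesoscopic pointwise bound `P2P ⟹ S(1/2)`).**
If `P_{p_c}(0 ↔ y in Λ_R) ≤ C R^{-1/2}` for every `R ≥ 1` and every `y ∈ Λ_R` outside the mesoscopic
box `Λ_{⌊R^{5/6}⌋}`, then `Σ_{y ∈ Λ_R} P_{p_c}(0 ↔ y in Λ_R) ≤ (27 + 27 max(C,0)) R^{5/2}` for every
`R ≥ 1`, i.e. `FreeSusceptibilityPowerSaving`.  Split the sum at `r = ⌊R^{5/6}⌋₊`: the inner part is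
`≤ #Λ_r ≤ 27 R^{5/2}` (each probability `≤ 1`), the outer part is `≤ #Λ_R · C₊ R^{-1/2} ≤ 27 C₊ R^{5/2}`.
[folklore] -/
theorem stub_p2pBridge :
    (∃ C : ℝ, ∀ R : ℕ, 1 ≤ R → ∀ y ∈ box 3 R, y ∉ box 3 ⌊(R : ℝ) ^ ((5 : ℝ) / 6)⌋₊ →
        (bondPercolation (zdGraph 3) (criticalProbI 3)).real (openConnIn ↑(box 3 R) 0 y)
          ≤ C * (R : ℝ) ^ (-(1 : ℝ) / 2)) →
      Summit.CriticalPhenomena.PercolationContinuityZ3.Theses.PercShatteringRace.FreeSusceptibilityPowerSaving := by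
  classical
  rintro ⟨C, hC⟩
  refine ⟨27 + 27 * max C 0, ?_⟩
  intro R hR
  set μ := bondPercolation (zdGraph 3) (criticalProbI 3) with hμ
  set r : ℕ := ⌊(R : ℝ) ^ ((5 : ℝ) / 6)⌋₊ with hr
  have hR1 : (1 : ℝ) ≤ R := by exact_mod_cast hR
  have hR0 : (0 : ℝ) < R := by linarith
  have hRnn : (0 : ℝ) ≤ R := hR0.le
  -- facts about `R^{5/6}` and `r`
  have hρ1 : (1 : ℝ) ≤ (R : ℝ) ^ ((5 : ℝ) / 6) := Real.one_le_rpow hR1 (by norm_num)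
  have hρ0 : (0 : ℝ) ≤ (R : ℝ) ^ ((5 : ℝ) / 6) := Real.rpow_nonneg hRnn _
  have hrle : (r : ℝ) ≤ (R : ℝ) ^ ((5 : ℝ) / 6) := Nat.floor_le hρ0
  -- the common nonnegative pointwise bound on the outer part
  have hXnn : (0 : ℝ) ≤ max C 0 * (R : ℝ) ^ (-(1 : ℝ) / 2) :=
    mul_nonneg (le_max_right _ _) (Real.rpow_nonneg hRnn _)
  -- inner part: at most `#Λ_r ≤ 27 R^{5/2}`
  have hin : ∑ y ∈ (box 3 R).filter (fun y => y ∈ box 3 r), μ.real (openConnIn ↑(box 3 R) 0 y)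
      ≤ 27 * (R : ℝ) ^ ((5 : ℝ) / 2) := by
    calc ∑ y ∈ (box 3 R).filter (fun y => y ∈ box 3 r), μ.real (openConnIn ↑(box 3 R) 0 y)
        ≤ ∑ y ∈ (box 3 R).filter (fun y => y ∈ box 3 r), (1 : ℝ) :=
          Finset.sum_le_sum fun y _ => measureReal_le_one
      _ = (((box 3 R).filter (fun y => y ∈ box 3 r)).card : ℝ) := by simp
      _ ≤ ((box 3 r).card : ℝ) := by
          exact_mod_cast Finset.card_le_card (fun y hy => (Finset.mem_filter.1 hy).2)
      _ = (2 * (r : ℝ) + 1) ^ 3 := by exact_mod_cast card_box 3 r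
      _ ≤ (3 * (R : ℝ) ^ ((5 : ℝ) / 6)) ^ 3 := by
          gcongr
          linarith
      _ = 27 * (R : ℝ) ^ ((5 : ℝ) / 2) := by
          rw [mul_pow, rpow_five_sixths_cube hRnn]
          norm_num
  -- outer part: at most `#Λ_R · C₊ R^{-1/2} ≤ 27 C₊ R^{5/2}`
  have hout : ∑ y ∈ (box 3 R).filter (fun y => y ∉ box 3 r), μ.real (openConnIn ↑(box 3 R) 0 y)
      ≤ 27 * max C 0 * (R : ℝ) ^ ((5 : ℝ) / 2) := by
    have hb : ∀ y ∈ (box 3 R).filter (fun y => y ∉ box 3 r),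
        μ.real (openConnIn ↑(box 3 R) 0 y) ≤ max C 0 * (R : ℝ) ^ (-(1 : ℝ) / 2) := by
      intro y hy
      obtain ⟨hyR, hyr⟩ := Finset.mem_filter.1 hy
      calc μ.real (openConnIn ↑(box 3 R) 0 y) ≤ C * (R : ℝ) ^ (-(1 : ℝ) / 2) := hC R hR y hyR hyr
        _ ≤ max C 0 * (R : ℝ) ^ (-(1 : ℝ) / 2) :=
          mul_le_mul_of_nonneg_right (le_max_left _ _) (Real.rpow_nonneg hRnn _)
    calc ∑ y ∈ (box 3 R).filter (fun y => y ∉ box 3 r), μ.real (openConnIn ↑(box 3 R) 0 y)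
        ≤ ∑ y ∈ (box 3 R).filter (fun y => y ∉ box 3 r), max C 0 * (R : ℝ) ^ (-(1 : ℝ) / 2) :=
          Finset.sum_le_sum hb
      _ = (((box 3 R).filter (fun y => y ∉ box 3 r)).card : ℝ)
            * (max C 0 * (R : ℝ) ^ (-(1 : ℝ) / 2)) := by
          rw [Finset.sum_const, nsmul_eq_mul]
      _ ≤ ((box 3 R).card : ℝ) * (max C 0 * (R : ℝ) ^ (-(1 : ℝ) / 2)) := by
          apply mul_le_mul_of_nonneg_right _ hXnn
          exact_mod_cast Finset.card_le_card (Finset.filter_subset _ _)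
      _ = (2 * (R : ℝ) + 1) ^ 3 * (max C 0 * (R : ℝ) ^ (-(1 : ℝ) / 2)) := by
          congr 1; exact_mod_cast card_box 3 R
      _ ≤ (3 * (R : ℝ)) ^ 3 * (max C 0 * (R : ℝ) ^ (-(1 : ℝ) / 2)) := by
          apply mul_le_mul_of_nonneg_right _ hXnn
          exact pow_le_pow_left₀ (by positivity) (by linarith) 3
      _ = 27 * max C 0 * ((R : ℝ) ^ (3 : ℕ) * (R : ℝ) ^ (-(1 : ℝ) / 2)) := by ring
      _ = 27 * max C 0 * (R : ℝ) ^ ((5 : ℝ) / 2) := by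
          rw [cube_mul_rpow_neg_half hR0]
  -- assemble
  calc ∑ y ∈ box 3 R, μ.real (openConnIn ↑(box 3 R) 0 y)
      = ∑ y ∈ (box 3 R).filter (fun y => y ∈ box 3 r), μ.real (openConnIn ↑(box 3 R) 0 y)
          + ∑ y ∈ (box 3 R).filter (fun y => y ∉ box 3 r), μ.real (openConnIn ↑(box 3 R) 0 y) :=
        (Finset.sum_filter_add_sum_filter_not _ _ _).symm
    _ ≤ 27 * (R : ℝ) ^ ((5 : ℝ) / 2) + 27 * max C 0 * (R : ℝ) ^ ((5 : ℝ) / 2) := add_le_add hin hout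
    _ = (27 + 27 * max C 0) * (R : ℝ) ^ ((5 : ℝ) / 2) := by ring

end Summit.CriticalPhenomena.PercolationContinuityZ3.Theorems

end
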